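/-
Copyright: the b2b-balaban T⁴-continuum CRUX team, row NE7b OWNER lineage `t4-ne7b-p1` (gen 124). Project licence.
-/
import Summits.QuantumFields.BalabanUV.T4Continuum.Spine.NE7b.SupZdCoarseInverseOperator

/-!
# THE INFINITE-VOLUME FLUCTUATION COVARIANCE ANNIHILATES BLOCK SOURCES — `C_∞Q′* = 0`: for `V : ℤ^d → [−λ, Λ]` (`d ≥ 3`, every mesh), ANY
# bounded block columns `Ψ` of `H_V` and ANY cube limit `M = T_∞⁻¹`, the response part of the block column `Ψ_{b₀} = H_V⁻¹𝟙_{B n b₀}`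
# ((201): `Σ′_{b″}m(b″)h_{b″}`, `m(b″) = T_∞(b″,b₀)` its block means, `h_{b″}` (200)'s response kernels) IS `Ψ_{b₀}`:
# `Σ′_{b″}T_∞(b″,b₀)Σ′_{b′}M(b′,b″)Ψ_{b′} = Ψ_{b₀}`, so its fluctuation part vanishes; with (201)'s `Q′C_∞ = 0` both projection identities of
# `C = H⁻¹ − H⁻¹Q′*(Q′H⁻¹Q′*)⁻¹Q′H⁻¹` hold on `ℤ^d` (row NE7b, node U5c; (180)∕(181)∕(186)∕(194)∕(195)∕(203) BY NAME; [folklore])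

Cell `pub-balaban`, sub-cell `t4`, spine estimate NE7b (`T4WeightBudget.RelWeightBound`; the cell's OWN estimate — NOT PRINTED in
[Bałaban 1983–89], NOT PROVED).  Crux-route work under `Spine/NE7b/` by the row OWNER (`t4-ne7b-p1` gen 124, file (209)) under FREEZE
(0)'s crux-prover clause; NOTHING of Bałaban's is named as a Lean object, valued or asserted; no `T4Continuum/Support` leaf typed; no `def`,
no notation (series WRITTEN OUT; `Ψ`, `M` ANY data with their displayed properties); zero `sorry`.  Imports (BY NAME): the OWNER's (203)
`…SupZdCoarseInverseOperator` (`kernel_comp_apply`; through it (195) `zd_coarse_inverse_mul`, (194) `zd_coarse_section_inverse`, (191)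
`natAbs_sub_comm_sum`, (186) `zd_coarse_entry_decay`, (181) `zd_bounded_solution_unique`, (180) `zd_propagator_exists`), Mathlib's
`tsum_eq_single`.

WHY (located).  The fluctuation covariance of the road is the `H`-orthogonal complement of the constraint directions: `Q′C = 0` (its
range has no block means — (201) on `ℤ^d`) and `CQ′* = 0` (block-constant sources have no fluctuation part).  On `ℤ^d` the second reads,
for the block source at `b₀` whose bounded solution is `Ψ_{b₀}` itself with block means `T_∞(b″,b₀)` ((187)'s symmetric entries):
`Σ′_{b″}T_∞(b″,b₀)·h_{b″}(p) = Σ′_{b′}(Σ′_{b″}M(b′,b″)T_∞(b″,b₀))Ψ_{b′}(p) = Σ′_{b′}δ_{b′b₀}Ψ_{b′}(p) = Ψ_{b₀}(p)` — one exchange of an absolutely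
convergent double series (the kernels `T_∞(·,b₀)`, `M` decay by (186)∕(194), `Ψ_{b′}(p)` is bounded in `b′` by (180)+(181): exactly (203)
`kernel_comp_apply`) and `MT_∞ = 1` ((195)).

WHAT IS PROVED ([folklore]): **`zd_covariance_kills_block_sources`** (for ALL `n`, `V` of the class, `Ψ`, cube limit `M`, `b₀`, `p`:
`Σ′_{b″}T_∞(b″,b₀)Σ′_{b′}M(b′,b″)Ψ_{b′}(p) = Ψ_{b₀}(p)`, i.e. the fluctuation part of `Ψ_{b₀}` in (201)'s display is `0`); §2 toy.

HONEST (what this is NOT).  Block sources (block-constant sources by finite superposition — not typed); the LINEAR column only; `d ≥ 3`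
only; scalar skeleton ((A3), NC-NE7b-α UNRULED); nothing of the covariant propagators of [B4]–[B6]; nothing of Bałaban's asserted.  BY-NAME
EFFECT ON THE WALL: NONE.  NE7b NOT PRINTED ∕ NOT PROVED; spine PROVED 0∕9; rung (B)+1 — the programme's measures remain FINITE-torus
statements; NOT the mass gap, NOT Clay.  HONEST DEPENDENCY: continuum YM on T⁴ ⇐ BetaPertH ∧ nine spine estimates (0∕9 proved); BetaPertH
⇐ (D1) ∧ (D4) ∧ CAP+tail; G-an2-4 gates asym, D1 and NE2∕3∕4.
-/

set_option autoImplicit false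

noncomputable section

namespace Summit.QuantumFields.BalabanUV.T4Continuum.NE7b.SupZdCovarianceProjection

open Real Filter Topology
open Literature.MathematicalPhysics.QuantumFieldTheory.Balaban1983to89
open B6QGQLower276 (X e blk B side chart mem_B sum_B sum_B_const card_cube blk_chart)
open SupZdPropagatorLimit (zd_propagator_exists)
open SupZdPropagatorUniqueness (zd_bounded_solution_unique)
open SupZdCoarseForm (natAbs_sub_comm_sum)
open SupZdCoarseOperator (zd_coarse_entry_decay)
open SupZdCoarseInverse (zd_coarse_section_inverse)
open SupZdCoarseInverseIdentities (zd_coarse_inverse_mul)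
open SupZdCoarseInverseOperator (kernel_comp_apply)

variable {d : ℕ}

/-! ## §1. THE END: the infinite-volume fluctuation covariance annihilates block sources -/

/-- **HEADLINE — `C_∞𝟙_{B n b₀} = 0`: THE RESPONSE PART OF A BLOCK COLUMN IS THE BLOCK COLUMN ITSELF**: `d ≥ 3`, `a > 0`, `λ < min(2,a)`,
`Λ ≥ 0`, `V : ℤ^d → [−λ, Λ]`, ANY bounded block columns `Ψ` of `H_V`, ANY cube limit `M` (= `T_∞⁻¹`): for every `b₀` and `p`,
`Σ′_{b″}T_∞(b″,b₀)·(Σ′_{b′}M(b′,b″)Ψ_{b′}(p)) = Ψ_{b₀}(p)` — the block means of `u = Ψ_{b₀} = H_V⁻¹𝟙_{B n b₀}` are `m(b″) = T_∞(b″,b₀)`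
((187)'s symmetry), so (201)'s response part `Σ′_{b″}m(b″)h_{b″}` of `u` is `Σ′_{b′}(Σ′_{b″}M(b′,b″)T_∞(b″,b₀))Ψ_{b′} = Ψ_{b₀}` by `MT_∞ = 1`
((195)) after ONE exchange of the absolutely convergent double series ((203) `kernel_comp_apply`, the `Ψ_{b′}(p)` bounded in `b′`): the
fluctuation part of a block source VANISHES — with (201)'s `Q′C_∞ = 0` the two projection identities `C_∞Q′* = 0 = Q′C_∞` of the road's
fluctuation covariance, on `ℤ^d`. [folklore] -/
theorem zd_covariance_kills_block_sources (hd : 3 ≤ d) (a : ℝ) (ha : 0 < a) {lam Lam : ℝ} (hlam : lam < min 2 a) (hLam : 0 ≤ Lam)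
    (n : ℕ) (V : X d → ℝ) (hV : ∀ p, -lam ≤ V p) (hV' : ∀ p, V p ≤ Lam)
    (Ψ : X d → X d → ℝ) (BΨ : X d → ℝ) (hΨB : ∀ b' p, |Ψ b' p| ≤ BΨ b')
    (hΨ : ∀ b' p, ((n : ℝ) + 1) ^ 2 * ∑ μ, (2 * Ψ b' p - Ψ b' (p + e μ) - Ψ b' (p - e μ))
      + a / ((n : ℝ) + 1) ^ d * ∑ q ∈ B n (blk n p), Ψ b' q + V p * Ψ b' p = if blk n p = b' then 1 else 0)
    (M : X d → X d → ℝ) (hM : ∀ b b' : X d, Tendsto (fun R : ℕ =>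
        if h : b ∈ (Fintype.piFinset fun _ : Fin d => Finset.Icc (-(R : ℤ)) R) ∧
            b' ∈ (Fintype.piFinset fun _ : Fin d => Finset.Icc (-(R : ℤ)) R)
          then (Matrix.of fun c c' : ↥(Fintype.piFinset fun _ : Fin d => Finset.Icc (-(R : ℤ)) R) =>
            (((n : ℝ) + 1) ^ d)⁻¹ * ∑ q ∈ B n (c : X d), Ψ (c' : X d) q)⁻¹ ⟨b, h.1⟩ ⟨b', h.2⟩ else 0)
      atTop (𝓝 (M b b')))
    (b₀ p : X d) :
    ∑' b'' : X d, ((((n : ℝ) + 1) ^ d)⁻¹ * ∑ q ∈ B n b'', Ψ b₀ q) * ∑' b' : X d, M b' b'' * Ψ b' p = Ψ b₀ p ∧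
    Ψ b₀ p - ∑' b'' : X d, ((((n : ℝ) + 1) ^ d)⁻¹ * ∑ q ∈ B n b'', Ψ b₀ q) * ∑' b' : X d, M b' b'' * Ψ b' p = 0 := by
  classical
  obtain ⟨C₀, δ₀, hC₀, hδ₀, H180⟩ := zd_propagator_exists (d := d) hd a ha hlam hLam
  obtain ⟨Ce, δe, hCe, hδe, H186⟩ := zd_coarse_entry_decay (d := d) hd a ha hlam hLam
  obtain ⟨c₁, δ₁, hc₁, hδ₁, H4⟩ := zd_coarse_section_inverse (d := d) hd a ha hlam hLam
  -- the three bounded∕decaying ingredients: `Ψ_{b′}(p)` bounded in `b′`, `T_∞(·,b₀)` and `M` decaying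
  have hΨC : ∀ b', |Ψ b' p| ≤ C₀ * 1 := by
    intro b'
    obtain ⟨v, hveq, hvdec⟩ := H180 n V hV hV' b' 1 (fun q => if blk n q = b' then (1 : ℝ) else 0)
      (fun q hq => by rw [if_neg hq]) (fun q => by split_ifs <;> simp)
    have hvB : ∀ q, |v q| ≤ C₀ * 1 := fun q =>
      (le_mul_of_one_le_left (abs_nonneg _) (one_le_exp (by positivity))).trans (hvdec q)
    have hΨv : Ψ b' = v := zd_bounded_solution_unique hd a ha hlam hLam n V hV hV' _ (Ψ b') v (hΨB b') hvB (hΨ b') hveq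
    rw [hΨv]; exact hvB p
  obtain ⟨T, hT⟩ : ∃ T : X d → X d → ℝ, ∀ b b', T b b' = (((n : ℝ) + 1) ^ d)⁻¹ * ∑ q ∈ B n b, Ψ b' q := ⟨_, fun _ _ => rfl⟩
  have hKd : ∀ b b'' : X d, |T b'' b| ≤ Ce * exp (-(δe * ∑ i, (((b i - b'' i).natAbs : ℕ) : ℝ))) := fun b b'' => by
    rw [hT, natAbs_sub_comm_sum b b'']; exact H186 n V hV hV' Ψ BΨ hΨB hΨ b'' b
  have hLd : ∀ b'' b' : X d, |M b' b''| ≤ c₁ * exp (-(δ₁ * ∑ i, (((b'' i - b' i).natAbs : ℕ) : ℝ))) := fun b'' b' => by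
    rw [natAbs_sub_comm_sum b'' b']
    refine le_of_tendsto' (hM b' b'').abs fun R => ?_
    split_ifs with h
    · exact (H4 n V hV hV' Ψ BΨ hΨB hΨ _ _ (Finset.Subset.refl _)).1 ⟨b', h.1⟩ ⟨b'', h.2⟩
    · rw [abs_zero]; positivity
  -- exchange, then `MT_∞ = 1`
  have hx := kernel_comp_apply hδe hδ₁ (fun b b'' => T b'' b) (fun b'' b' => M b' b'') hKd hLd (fun b' => Ψ b' p) hΨC b₀
  have hMT : ∀ b', ∑' b'' : X d, T b'' b₀ * M b' b'' = if b' = b₀ then 1 else 0 := fun b' => by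
    have h := (zd_coarse_inverse_mul hd a ha hlam hLam n V hV hV' Ψ BΨ hΨB hΨ M hM b' b₀).2
    simp only [← hT] at h
    rw [← h]; exact tsum_congr fun b'' => mul_comm _ _
  simp only [hMT] at hx
  have hR : ∑' b' : X d, (if b' = b₀ then (1 : ℝ) else 0) * Ψ b' p = Ψ b₀ p := by
    rw [tsum_eq_single b₀ (fun b' hb' => by rw [if_neg hb', zero_mul]), if_pos rfl, one_mul]
  rw [hR] at hx
  simp only [hT] at hx
  exact ⟨hx, by rw [hx, sub_self]⟩

/-! ## §2. Toy -/

/-- Toy (`d = 3`, `a = 1`, `λ = 0`, `Λ = 1`): the decay constants of the coarse entries exist. -/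
example : ∃ C δ : ℝ, 0 < C ∧ 0 < δ :=
  let ⟨C, δ, hC, hδ, _⟩ := zd_coarse_entry_decay (d := 3) le_rfl 1 one_pos (lam := 0) (Lam := 1)
    (by rw [min_eq_right (by norm_num : (1 : ℝ) ≤ 2)]; norm_num) zero_le_one
  ⟨C, δ, hC, hδ⟩

end Summit.QuantumFields.BalabanUV.T4Continuum.NE7b.SupZdCovarianceProjection
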